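import Literature.AlgebraicGeometry.ModuliOfAbelianVarieties.Lan2013.Sec46KodairaSpencerDegeneration
import HarnessLib

/-!
# [Lan2013] §4.6.1–§4.6.2 — companion `Holds` file: consequences among the named facts of
# `Sec46KodairaSpencerDegeneration` (RULING TS-1: proofs live here, never in the statement carpet)

* `Lan2013_4623_of_4622` — COROLLARY 4.6.2.3 (`Ext¹_{𝒪_S}(𝒪_A, 𝒪_A)^Y = Ext¹_{𝒪_S}(𝒪_A, 𝒪_A) ≅ Lie_{A^∨/S}`) as typed
  (`Lan2013_4623_ext1_invariants`) FOLLOWS from LEMMA 4.6.2.2 (`Lan2013_4622_Y_acts_trivially`) at `i = 1`, exactly as print derives it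
  («By Proposition 2.1.5.14, it suffices to treat the case `i = 1` …»); recorded so that a discharge of 4.6.2.2 discharges 4.6.2.3 (squad QA
  T-ref7 QA7-1, D-0026 double-debt hygiene).  No new definitions, no new facts.

## References
* [Lan2013PELCompactifications] K.-W. Lan, *Arithmetic compactifications of PEL-type Shimura varieties*, LMS Monographs 36 (2013), Lem. 4.6.2.2,
  Cor. 4.6.2.3 (p. 265; 2010 rev. p. 299).
-/

namespace Literature.AlgebraicGeometry.ModuliOfAbelianVarieties.Lan2013.Sec46KodairaSpencerDegeneration

universe u

/-- COROLLARY 4.6.2.3 from LEMMA 4.6.2.2 (the `Y`-action on `H¹(A, 𝒪_A)` is trivial, hence so is the transported action on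
`Ext¹_{𝒪_S}(𝒪_A, 𝒪_A) ≅ H¹(A, 𝒪_A)`). [cite: Lan2013PELCompactifications, Cor. 4.6.2.3 (p. 265)] -/
theorem Lan2013_4623_of_4622 {R₀ : Type u} [CommRing R₀] {R : Type u} [CommRing R] [Algebra R₀ R] (𝔓 : PeriodKSDatum R₀ R)
    (h : Lan2013_4622_Y_acts_trivially 𝔓) : Lan2013_4623_ext1_invariants 𝔓 := by
  intro y e
  have hy : 𝔓.yAct y 1 = LinearMap.id := h y 1
  rw [hy, LinearMap.id_apply]

end Literature.AlgebraicGeometry.ModuliOfAbelianVarieties.Lan2013.Sec46KodairaSpencerDegeneration
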